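import Mathlib
import Literature.MathematicalPhysics.MHD.BallooningSAlpha
import HarnessLib

/-!
# The STABLE side of the `s–α` ballooning energy: Picone's identity in Riccati form — a log-derivative field `w` with non-positive Riccati residual `(pw)′ + pw² + q ≤ 0` on a window makes the one-surface energy of EVERY differentiable trial function vanishing at the window ends non-negative

LADDER-GRIDFUSION rung F3 (cell `gridfusion`; lead g12 RULING 9ey (2) «#199-cand F3.BALLOON-sα-STABLE-…»: the two-sided
closure of the ballooning lane — ★ #184 / #192 certify NEGATIVE directions, this file is the engine of the opposite verdict).
Statements + proofs by gridfusion-model-7 g8, 2026-08-28, over gridfusion-lit-3's `Literature/MathematicalPhysics/MHD/BallooningSAlpha.lean`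
(`SAlpha.bending = 1 + Λ²`, `SAlpha.drive = α(Λ sin θ + cos θ)`, `SAlpha.energyDensity`, `SAlpha.energy`, `SAlpha.UnstableWitness`).
0 kit, 0 named facts.

## What is PROVED (every `s, α`; the instance `(1, 2/5)` is in `SAlphaStableWindow`)
* `density_eq_riccati` — the POINTWISE PICONE IDENTITY in Riccati form: for any functions `X, X′, w, (pw)′`,
  `(1+Λ²)X′² − qX² = (1+Λ²)(X′ − wX)² + [2XX′(1+Λ²)w + X²(pw)′] − X²·Ric`, `Ric := (pw)′ + (1+Λ²)w² + q` (pure algebra;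
  the bracket is the derivative of `X²(1+Λ²)w` when `X′` is the derivative of `X` and `(pw)′` that of `(1+Λ²)w`);
* `energy_nonneg_of_riccati` — ON A WINDOW `[a, b]`: if `w` is continuous with `(1+Λ²)w` differentiable (continuous
  derivative) and `Ric ≤ 0` on `[a, b]`, then EVERY `X` differentiable on `[a, b]` with `X(a) = X(b) = 0` whose energy
  density is integrable has `W[X; a, b] ≥ 0` (the derivative `X′` is NOT assumed continuous: its measurability is taken
  from `deriv`, its square-integrability from the integrable density — exactly the generality of `SAlpha.UnstableWitness`);
* `not_unstableWitness_of_riccati` — hence NO `SAlpha.UnstableWitness` lives in such a window (a non-integrable density has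
  integral `0`, not `< 0`).
The classical reading: `w = u′/u` for a positive (super)solution `u` of the `s–α` equation (12.97) — Jacobi's
criterion / disconjugacy (Hartman Ch. XI); the Riccati form avoids square roots when `u = f·(1+Λ²)^{-1/2}`.

## THREE COLUMNS
CERTIFIED: the two kernel theorems above, for the `s–α` MODEL's one-surface functional as typed by lit-3.  VALIDATED: nothing
numerical.  MODELLED: `s–α` model (Freidberg (12.96)–(12.99)); «stable on the window» below means: no compactly supported
trial function inside the window has negative one-surface energy — the converse direction of the printed «find an `X` with
`W̄ < 0` ⇒ unstable»; nothing about a device, no `β`-limit.  Citations: Freidberg 2014 §12.3 (12.38)–(12.40), §12.6.2 (12.97)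
[Freidberg2014]; Picone's identity: Hartman 2002 Ch. XI Thm. 6.2 [Hartman2002].
-/

noncomputable section

open Real MeasureTheory intervalIntegral Set
open Literature.MathematicalPhysics.MHD.Ballooning

namespace Summit.Ventures.FusionMHD.Models

namespace SAlphaRiccati

/-- The RICCATI RESIDUAL of a log-derivative candidate `w` (with `pw′` the derivative of `(1+Λ²)w`):
`Ric = (pw)′ + (1+Λ²)w² + α(Λ sin θ + cos θ)`; for `w = u′/u` it is `((1+Λ²)u′)′/u + q`, the `s–α` operator (12.97)
applied to `u`, divided by `u`. [cite: Hartman2002, Ch. XI Thm. 6.2] -/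
def riccati (s α : ℝ) (w pw' : ℝ → ℝ) (θ : ℝ) : ℝ :=
  pw' θ + SAlpha.bending s α θ * w θ ^ 2 + SAlpha.drive s α θ

/-- THE POINTWISE PICONE IDENTITY (Riccati form), pure algebra:
`(1+Λ²)X′² − qX² = (1+Λ²)(X′ − wX)² + [2XX′(1+Λ²)w + X²(pw)′] − X²·Ric`. [cite: Hartman2002, Ch. XI Thm. 6.2] -/
theorem density_eq_riccati (s α : ℝ) (X X' w pw' : ℝ → ℝ) (θ : ℝ) :
    SAlpha.energyDensity s α X X' θ
      = SAlpha.bending s α θ * (X' θ - w θ * X θ) ^ 2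
        + (2 * X θ * X' θ * (SAlpha.bending s α θ * w θ) + X θ ^ 2 * pw' θ)
        - X θ ^ 2 * riccati s α w pw' θ := by
  unfold SAlpha.energyDensity riccati
  ring

/-- `1 + Λ²` is continuous in `θ`. [cite: Freidberg2014, §12.6.2 eq. (12.97)] -/
theorem continuous_bending (s α : ℝ) : Continuous (SAlpha.bending s α) := by
  unfold SAlpha.bending SAlpha.shearParam; fun_prop

/-- The drive `α(Λ sin θ + cos θ)` is continuous in `θ`. [cite: Freidberg2014, §12.6.2 eq. (12.97)] -/
theorem continuous_drive (s α : ℝ) : Continuous (SAlpha.drive s α) := by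
  unfold SAlpha.drive SAlpha.shearParam; fun_prop

/-- PICONE ⇒ NON-NEGATIVE ENERGY ON A WINDOW.  If `w` is continuous on `[a, b]`, `(1+Λ²)w` has a derivative `pw′` there
with `pw′` continuous, and the Riccati residual is `≤ 0` on `[a, b]`, then every `X` differentiable on `[a, b]` (derivative
`X′`, any function) with `X(a) = X(b) = 0` and integrable energy density has `0 ≤ W[X; a, b]`.  Proof: integrate the
pointwise identity; the bracket is the derivative of `X²(1+Λ²)w`, which vanishes at both ends; the first term is `≥ 0`
and `−X²·Ric ≥ 0`.  (`X′` is measurable as `deriv X`, square-integrable because the density is integrable.)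
[cite: Hartman2002, Ch. XI Thm. 6.2] -/
theorem energy_nonneg_of_riccati {s α a b : ℝ} {X X' w pw' : ℝ → ℝ} (hab : a ≤ b)
    (hX : ∀ θ ∈ uIcc a b, HasDerivAt X (X' θ) θ)
    (hw : ∀ θ ∈ uIcc a b, HasDerivAt (fun θ => SAlpha.bending s α θ * w θ) (pw' θ) θ)
    (hwc : ContinuousOn w (uIcc a b)) (hpwc : ContinuousOn pw' (uIcc a b))
    (hric : ∀ θ ∈ uIcc a b, riccati s α w pw' θ ≤ 0)
    (ha : X a = 0) (hb : X b = 0)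
    (hint : IntervalIntegrable (fun θ => SAlpha.energyDensity s α X X' θ) volume a b) :
    0 ≤ SAlpha.energy s α X X' a b := by
  have hI : uIcc a b = Icc a b := uIcc_of_le hab
  -- continuity facts on the window
  have hXc : ContinuousOn X (uIcc a b) := fun θ hθ => (hX θ hθ).continuousAt.continuousWithinAt
  have hpc : ContinuousOn (SAlpha.bending s α) (uIcc a b) := (continuous_bending s α).continuousOn
  have hqc : ContinuousOn (SAlpha.drive s α) (uIcc a b) := (continuous_drive s α).continuousOn
  have hpwc' : ContinuousOn (fun θ => SAlpha.bending s α θ * w θ) (uIcc a b) := hpc.mul hwc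
  -- the boundary function G = X²·(1+Λ²)w and its derivative
  set G : ℝ → ℝ := fun θ => X θ ^ 2 * (SAlpha.bending s α θ * w θ) with hGdef
  set G' : ℝ → ℝ := fun θ => 2 * X θ * X' θ * (SAlpha.bending s α θ * w θ) + X θ ^ 2 * pw' θ with hG'def
  have hG : ∀ θ ∈ uIcc a b, HasDerivAt G (G' θ) θ := by
    intro θ hθ
    have h1 := ((hX θ hθ).mul (hX θ hθ)).mul (hw θ hθ)
    have e : G = fun y => X y * X y * (SAlpha.bending s α y * w y) := by
      funext y; simp only [hGdef]; ring
    rw [e]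
    refine h1.congr_deriv ?_
    simp only [hG'def, Pi.mul_apply]
    ring
  -- (1+Λ²)X′² is integrable: it is density + qX²
  have hpX2 : IntervalIntegrable (fun θ => SAlpha.bending s α θ * X' θ ^ 2) volume a b := by
    have h1 : IntervalIntegrable (fun θ => SAlpha.drive s α θ * X θ ^ 2) volume a b :=
      (hqc.mul (hXc.pow 2)).intervalIntegrable
    have e : (fun θ => SAlpha.bending s α θ * X' θ ^ 2)
        = fun θ => SAlpha.energyDensity s α X X' θ + SAlpha.drive s α θ * X θ ^ 2 := by
      funext θ; unfold SAlpha.energyDensity; ring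
    rw [e]
    exact hint.add h1
  -- X′² is integrable (divide by the continuous positive 1+Λ²)
  have hX2 : IntervalIntegrable (fun θ => X' θ ^ 2) volume a b := by
    have hinv : ContinuousOn (fun θ => (SAlpha.bending s α θ)⁻¹) (uIcc a b) :=
      hpc.inv₀ fun θ _ => (SAlpha.bending_pos s α θ).ne'
    have h1 := hpX2.mul_continuousOn hinv
    refine h1.congr ?_
    intro θ _
    have hp : SAlpha.bending s α θ ≠ 0 := (SAlpha.bending_pos s α θ).ne'
    field_simp
  -- X′ is a.e.-strongly measurable on the window: it is `deriv X` there
  have hX'm : AEStronglyMeasurable X' (volume.restrict (Ioc a b)) := by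
    have h1 : ∀ᵐ θ ∂(volume.restrict (Ioc a b)), deriv X θ = X' θ :=
      ae_restrict_of_forall_mem measurableSet_Ioc fun θ hθ =>
        (hX θ (by rw [hI]; exact Ioc_subset_Icc_self hθ)).deriv
    exact (measurable_deriv X).aestronglyMeasurable.congr h1
  -- the cross term 2XX′(1+Λ²)w is integrable: dominated by M(1 + X′²)
  have hcross : IntervalIntegrable (fun θ => 2 * X θ * X' θ * (SAlpha.bending s α θ * w θ)) volume a b := by
    have hhc : ContinuousOn (fun θ => 2 * X θ * (SAlpha.bending s α θ * w θ)) (uIcc a b) :=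
      (continuousOn_const.mul hXc).mul hpwc'
    obtain ⟨M, hM⟩ := isCompact_uIcc.exists_bound_of_continuousOn hhc
    have hM0 : 0 ≤ M := by
      have := hM a left_mem_uIcc
      exact (norm_nonneg _).trans this
    rw [intervalIntegrable_iff_integrableOn_Ioc_of_le hab] at hX2 ⊢
    have hdom : IntegrableOn (fun θ => M * (1 + X' θ ^ 2)) (Ioc a b) volume := by
      have h1 : IntegrableOn (fun θ => (1 : ℝ) + X' θ ^ 2) (Ioc a b) volume :=
        (integrableOn_const (by simp [Real.volume_Ioc])).add hX2
      exact h1.const_mul M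
    have hmeas : AEStronglyMeasurable (fun θ => 2 * X θ * X' θ * (SAlpha.bending s α θ * w θ))
        (volume.restrict (Ioc a b)) := by
      have h2 : AEStronglyMeasurable (fun θ => 2 * X θ * (SAlpha.bending s α θ * w θ)) (volume.restrict (Ioc a b)) :=
        (hhc.mono (by rw [hI]; exact Ioc_subset_Icc_self)).aestronglyMeasurable measurableSet_Ioc
      have h3 := h2.mul hX'm
      refine h3.congr ?_
      filter_upwards with θ
      simp only [Pi.mul_apply]
      ring
    refine Integrable.mono' hdom hmeas ?_
    refine ae_restrict_of_forall_mem measurableSet_Ioc fun θ hθ => ?_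
    have hθ' : θ ∈ uIcc a b := by rw [hI]; exact Ioc_subset_Icc_self hθ
    have h1 : ‖2 * X θ * (SAlpha.bending s α θ * w θ)‖ ≤ M := hM θ hθ'
    rw [Real.norm_eq_abs] at h1 ⊢
    have e : 2 * X θ * X' θ * (SAlpha.bending s α θ * w θ) = X' θ * (2 * X θ * (SAlpha.bending s α θ * w θ)) := by ring
    rw [e, abs_mul]
    have h2 : |X' θ| ≤ 1 + X' θ ^ 2 := by nlinarith [abs_nonneg (X' θ), sq_abs (X' θ)]
    calc |X' θ| * |2 * X θ * (SAlpha.bending s α θ * w θ)| ≤ (1 + X' θ ^ 2) * M :=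
          mul_le_mul h2 h1 (abs_nonneg _) (by positivity)
      _ = M * (1 + X' θ ^ 2) := by ring
  -- hence G′ is integrable, and ∫ G′ = G b − G a = 0
  have hG'int : IntervalIntegrable G' volume a b := by
    have h2 : IntervalIntegrable (fun θ => X θ ^ 2 * pw' θ) volume a b := ((hXc.pow 2).mul hpwc).intervalIntegrable
    exact hcross.add h2
  have hFTC : ∫ θ in a..b, G' θ = 0 := by
    rw [intervalIntegral.integral_eq_sub_of_hasDerivAt hG hG'int]
    simp [hGdef, ha, hb]
  -- split the energy: density = (density − G′) + G′, the first summand is pointwise ≥ 0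
  have hrest : IntervalIntegrable (fun θ => SAlpha.energyDensity s α X X' θ - G' θ) volume a b := hint.sub hG'int
  have e1 : SAlpha.energy s α X X' a b
      = (∫ θ in a..b, (SAlpha.energyDensity s α X X' θ - G' θ)) + ∫ θ in a..b, G' θ := by
    unfold SAlpha.energy
    rw [← intervalIntegral.integral_add hrest hG'int]
    congr 1; funext θ; ring
  rw [e1, hFTC, add_zero]
  apply intervalIntegral.integral_nonneg hab
  intro θ hθ
  have hθ' : θ ∈ uIcc a b := by rw [hI]; exact hθ
  have hid := density_eq_riccati s α X X' w pw' θ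
  have hp := SAlpha.bending_pos s α θ
  have h1 : 0 ≤ SAlpha.bending s α θ * (X' θ - w θ * X θ) ^ 2 := by positivity
  have h2 : 0 ≤ -(X θ ^ 2 * riccati s α w pw' θ) := by
    have := hric θ hθ'
    nlinarith [sq_nonneg (X θ)]
  simp only [hG'def]
  linarith

/-- NO INSTABILITY WITNESS IN A RICCATI WINDOW: under the hypotheses of `energy_nonneg_of_riccati` on `w` over
`[A, B]`, no `SAlpha.UnstableWitness s α a b X X′` exists with `A ≤ a`, `b ≤ B` (a non-integrable density has energy
`0` by the integral convention, an integrable one has energy `≥ 0`). [cite: Hartman2002, Ch. XI Thm. 6.2] -/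
theorem not_unstableWitness_of_riccati {s α A B a b : ℝ} {X X' w pw' : ℝ → ℝ} (hAa : A ≤ a) (hbB : b ≤ B)
    (hw : ∀ θ ∈ Icc A B, HasDerivAt (fun θ => SAlpha.bending s α θ * w θ) (pw' θ) θ)
    (hwc : ContinuousOn w (Icc A B)) (hpwc : ContinuousOn pw' (Icc A B))
    (hric : ∀ θ ∈ Icc A B, riccati s α w pw' θ ≤ 0) :
    ¬ SAlpha.UnstableWitness s α a b X X' := by
  unfold SAlpha.UnstableWitness
  rintro ⟨hab, hX, hXa, hXb, hneg⟩
  have hI : uIcc a b = Icc a b := uIcc_of_le hab.le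
  have hsub : uIcc a b ⊆ Icc A B := by
    rw [hI]; exact Icc_subset_Icc hAa hbB
  by_cases hint : IntervalIntegrable (fun θ => SAlpha.energyDensity s α X X' θ) volume a b
  · have h := energy_nonneg_of_riccati hab.le hX (fun θ hθ => hw θ (hsub hθ)) (hwc.mono hsub) (hpwc.mono hsub)
      (fun θ hθ => hric θ (hsub hθ)) hXa hXb hint
    linarith
  · have h0 : SAlpha.energy s α X X' a b = 0 := by
      unfold SAlpha.energy
      exact intervalIntegral.integral_undef hint
    linarith

end SAlphaRiccati

end Summit.Ventures.FusionMHD.Models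

end
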